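import Mathlib
import HarnessLib
import Literature.MathematicalPhysics.QuantumLattice.HubbardCommutatorBound
import Literature.MathematicalPhysics.QuantumLattice.DWaveSourceProofs
import Literature.MathematicalPhysics.QuantumLattice.PairFieldMomentum
import Literature.MathematicalPhysics.QuantumLattice.HubbardTorusCharges
import Literature.MathematicalPhysics.QuantumLattice.TorusCooperSum

/-!
# Route `WeakCouplingBCS` — crux `WcbcsBcsConstruction` (stmt-HubbardSuperconductivity-2010),
# line `lro-seed-kink-bridge`, stub `stub_doubleCommutatorBound`

Graded-locality bound on the double commutator of the `d`-wave order operator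
`O = Δ_d + Δ_d†` (`Δ_d = pairField dWaveFormFactor L`) with the grand-canonical torus Hubbard
Hamiltonian `H = hubbardTorusWith 2 L 1 U μ`: `‖[O, [O, H]]‖ ≤ B₂ (1 + U + |μ|) L²`.

Proof: `O = Σ_x q_x` with `q_x = P_x + P_x†` even and localised on the `≤ 5` sites
`x + e`, `e ∈ {0, ±e₁, ±e₂}`; `H = Σ_Z h_Z` (`sum_hubbardTermOp`), each `h_Z` even, of norm
`≤ 2|t| + |U| + 2|μ|`, and at most `5 · 9` of them meet the support of `q_x` (degree `≤ 4`);
`[q_x, h_Z]` is even and localised on `supp q_x ∪ supp h_Z` (`≤ 7` sites), so by graded locality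
(`commute_of_mem_carEvenSubalgebra`) `[q_y, [q_x, h_Z]] = 0` unless `supp q_y` meets that set, which
happens for at most `7 · 5` values of `y`. Summing the `O(L²)` surviving terms gives the bound
(Koma–Tasaki 1994, proof of Theorem 2.2, with this norm count replacing their `[o_x, o_y] = 0`).
The argument is carried out on a general finite graph of bounded degree for an abstract family of
even local observables `q_y` (`dc_norm_doubleCommutator_le`) and specialised to the torus at the end.
-/

namespace Summit.HubbardSuperconductivity.HubbardSuperconductivity.Theorems

open Literature.MathematicalPhysics.QuantumLattice Literature.Probability.LatticeModels Matrix Filter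
open scoped Matrix.Norms.L2Operator ComplexOrder Topology

/-! ### Graded locality on a general finite graph -/

section General

variable {Λ : Type*} [LinearOrder Λ] [Fintype Λ]

/-- The commutator with a finite sum in the second slot, `A (Σ f) - (Σ f) A = Σ (A fᵢ - fᵢ A)`. [folklore] -/
theorem dc_commutator_finset_sum {n : Type*} [Fintype n] {ι : Type*} (s : Finset ι)
    (A : Matrix n n ℂ) (f : ι → Matrix n n ℂ) :
    A * (∑ i ∈ s, f i) - (∑ i ∈ s, f i) * A = ∑ i ∈ s, (A * f i - f i * A) := by
  rw [Finset.mul_sum, Finset.sum_mul, ← Finset.sum_sub_distrib]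

/-- `c_i c_j` is even for `i, j ∈ S`. [folklore] -/
theorem dc_annihilation_mul_annihilation_mem_carEvenSubalgebra {ι : Type*} [LinearOrder ι]
    [Fintype ι] {S : Finset ι} {i j : ι} (hi : i ∈ S) (hj : j ∈ S) :
    annihilation i * annihilation j ∈ carEvenSubalgebra S :=
  Algebra.subset_adjoin ⟨(i, false), (j, false), hi, hj, rfl⟩

/-- `c†_i c†_j` is even for `i, j ∈ S`. [folklore] -/
theorem dc_creation_mul_creation_mem_carEvenSubalgebra {ι : Type*} [LinearOrder ι]
    [Fintype ι] {S : Finset ι} {i j : ι} (hi : i ∈ S) (hj : j ∈ S) :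
    creation i * creation j ∈ carEvenSubalgebra S :=
  Algebra.subset_adjoin ⟨(i, true), (j, true), hi, hj, rfl⟩

/-- The singlet bond pair `b_{uv} = c_{u↑}c_{v↓} - c_{u↓}c_{v↑}` is an even element of the CAR
algebra of any set of sites containing `u, v`. [folklore] -/
theorem dc_bondPair_mem_carEvenSubalgebra {W : Finset Λ} {u v : Λ} (hu : u ∈ W) (hv : v ∈ W) :
    Literature.Barriers.HubbardSuperconductivity.bondPair u v ∈ carEvenSubalgebra (orbSet W) :=
  Subalgebra.sub_mem _
    (dc_annihilation_mul_annihilation_mem_carEvenSubalgebra (orb_mem_orbSet hu 0) (orb_mem_orbSet hv 1))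
    (dc_annihilation_mul_annihilation_mem_carEvenSubalgebra (orb_mem_orbSet hu 1) (orb_mem_orbSet hv 0))

/-- … and so is its adjoint `(b_{uv})† = c†_{v↓}c†_{u↑} - c†_{v↑}c†_{u↓}`. [folklore] -/
theorem dc_bondPair_conjTranspose_mem_carEvenSubalgebra {W : Finset Λ} {u v : Λ} (hu : u ∈ W)
    (hv : v ∈ W) :
    (Literature.Barriers.HubbardSuperconductivity.bondPair u v)ᴴ ∈ carEvenSubalgebra (orbSet W) := by
  rw [Literature.Barriers.HubbardSuperconductivity.bondPair_conjTranspose]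
  exact Subalgebra.sub_mem _
    (dc_creation_mul_creation_mem_carEvenSubalgebra (orb_mem_orbSet hv 1) (orb_mem_orbSet hu 0))
    (dc_creation_mul_creation_mem_carEvenSubalgebra (orb_mem_orbSet hv 0) (orb_mem_orbSet hu 1))

/-- A weighted sum of bond pairs `Σ_e c_e b_{u, v_e}` plus its adjoint is an even element of the
CAR algebra of any set of sites containing `u` and all `v_e` (generic form of the locality of
`P_x + P_x†`). [folklore] -/
theorem dc_sum_smul_bondPair_add_conjTranspose_mem {W : Finset Λ} (S : Finset (Site 2))
    (c : Site 2 → ℂ) {u : Λ} (v : Site 2 → Λ) (hu : u ∈ W) (hv : ∀ e ∈ S, v e ∈ W) :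
    (∑ e ∈ S, c e • Literature.Barriers.HubbardSuperconductivity.bondPair u (v e)) +
        (∑ e ∈ S, c e • Literature.Barriers.HubbardSuperconductivity.bondPair u (v e))ᴴ ∈
      carEvenSubalgebra (orbSet W) := by
  refine Subalgebra.add_mem _ (Subalgebra.sum_mem _ fun e he =>
    Subalgebra.smul_mem _ (dc_bondPair_mem_carEvenSubalgebra hu (hv e he)) _) ?_
  rw [conjTranspose_sum]
  refine Subalgebra.sum_mem _ fun e he => ?_
  rw [conjTranspose_smul]
  exact Subalgebra.smul_mem _ (dc_bondPair_conjTranspose_mem_carEvenSubalgebra hu (hv e he)) _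

variable (G : SimpleGraph Λ) [DecidableRel G.Adj]

omit [DecidableRel G.Adj] in
/-- The commutator of an even element localised on `W` with a local Hubbard term `h_Z` is even and
localised on `W ∪ supp Z`. [folklore] -/
theorem dc_commutator_hubbardTermOp_mem_carEvenSubalgebra (t U μ : ℝ) {W : Finset Λ}
    {A : Matrix (Finset (Orb Λ)) (Finset (Orb Λ)) ℂ} (hA : A ∈ carEvenSubalgebra (orbSet W))
    (Z : HubbardIdx G) :
    A * hubbardTermOp G t U μ Z - hubbardTermOp G t U μ Z * A ∈
      carEvenSubalgebra (orbSet (W ∪ hubbardTermSupp G Z)) := by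
  have hA' : A ∈ carEvenSubalgebra (orbSet (W ∪ hubbardTermSupp G Z)) :=
    carEvenSubalgebra_mono (orbSet_mono Finset.subset_union_left) hA
  have hZ : hubbardTermOp G t U μ Z ∈ carEvenSubalgebra (orbSet (W ∪ hubbardTermSupp G Z)) :=
    carEvenSubalgebra_mono (orbSet_mono Finset.subset_union_right)
      (hubbardTermOp_mem_carEvenSubalgebra G t U μ Z)
  exact Subalgebra.sub_mem _ (Subalgebra.mul_mem _ hA' hZ) (Subalgebra.mul_mem _ hZ hA')

/-- **Sum of the norms of the commutators of a local observable with the Hubbard terms**: on a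
graph of maximal degree `≤ Δ`, for `A` in the CAR algebra of the sites `W`,
`Σ_Z ‖[A, h_Z]‖ ≤ |W|(2Δ+1) · 2(2|t| + |U| + 2|μ|) ‖A‖` — only the `≤ |W|(2Δ+1)` terms meeting
`W` contribute (graded locality), each at most `2 ‖h_Z‖ ‖A‖`. [folklore] -/
theorem dc_sum_norm_commutator_hubbardTermOp_le {Δ : ℕ}
    (hΔ : ∀ x : Λ, (Finset.univ.filter fun y => G.Adj x y).card ≤ Δ) (t U μ : ℝ) {W : Finset Λ}
    {A : Matrix (Finset (Orb Λ)) (Finset (Orb Λ)) ℂ} (hA : A ∈ carSubalgebra (orbSet W)) :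
    ∑ Z, ‖A * hubbardTermOp G t U μ Z - hubbardTermOp G t U μ Z * A‖ ≤
      (W.card * (2 * Δ + 1) : ℕ) * (2 * (2 * |t| + |U| + 2 * |μ|) * ‖A‖) := by
  -- adapted from `norm_commutator_hamiltonianWith_le` (HubbardCommutatorBound.lean)
  have hvanish : ∀ Z, Disjoint (hubbardTermSupp G Z) W →
      A * hubbardTermOp G t U μ Z - hubbardTermOp G t U μ Z * A = 0 := fun Z hZ =>
    sub_eq_zero.mpr (commute_of_mem_carEvenSubalgebra (hubbardTermOp_mem_carEvenSubalgebra G t U μ Z)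
      hA (disjoint_orbSet hZ)).eq.symm
  rw [← Finset.sum_filter_of_ne (p := fun Z => ¬ Disjoint (hubbardTermSupp G Z) W)
    (fun Z _ hne hdis => hne (by rw [hvanish Z hdis, norm_zero]))]
  have hterm : ∀ Z, ‖A * hubbardTermOp G t U μ Z - hubbardTermOp G t U μ Z * A‖ ≤
      2 * (2 * |t| + |U| + 2 * |μ|) * ‖A‖ := fun Z => by
    have hZ := norm_hubbardTermOp_le G t U μ Z
    calc ‖A * hubbardTermOp G t U μ Z - hubbardTermOp G t U μ Z * A‖
        ≤ ‖A * hubbardTermOp G t U μ Z‖ + ‖hubbardTermOp G t U μ Z * A‖ := norm_sub_le _ _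
      _ ≤ ‖A‖ * ‖hubbardTermOp G t U μ Z‖ + ‖hubbardTermOp G t U μ Z‖ * ‖A‖ :=
          add_le_add (norm_mul_le _ _) (norm_mul_le _ _)
      _ = 2 * ‖hubbardTermOp G t U μ Z‖ * ‖A‖ := by ring
      _ ≤ 2 * (2 * |t| + |U| + 2 * |μ|) * ‖A‖ := by gcongr
  calc ∑ Z ∈ Finset.univ.filter (fun Z => ¬ Disjoint (hubbardTermSupp G Z) W),
          ‖A * hubbardTermOp G t U μ Z - hubbardTermOp G t U μ Z * A‖
      ≤ ∑ _Z ∈ Finset.univ.filter (fun Z => ¬ Disjoint (hubbardTermSupp G Z) W),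
          2 * (2 * |t| + |U| + 2 * |μ|) * ‖A‖ := Finset.sum_le_sum fun Z _ => hterm Z
    _ = (Finset.univ.filter (fun Z => ¬ Disjoint (hubbardTermSupp G Z) W)).card *
          (2 * (2 * |t| + |U| + 2 * |μ|) * ‖A‖) := by rw [Finset.sum_const, nsmul_eq_mul]
    _ ≤ (W.card * (2 * Δ + 1) : ℕ) * (2 * (2 * |t| + |U| + 2 * |μ|) * ‖A‖) := by
          have hc := card_filter_not_disjoint_hubbardTermSupp_le G hΔ W
          have hnn : 0 ≤ 2 * (2 * |t| + |U| + 2 * |μ|) * ‖A‖ := by positivity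
          exact mul_le_mul_of_nonneg_right (by exact_mod_cast hc) hnn

omit [DecidableRel G.Adj] G in
/-- **Graded locality for a family of local observables**: if `q_y` lies in the CAR algebra of the
sites `V y` with `‖q_y‖ ≤ M`, and `c` is even and localised on `A`, then
`Σ_y ‖[q_y, c]‖ ≤ #{y : V y meets A} · 2M‖c‖`. [folklore] -/
theorem dc_sum_norm_commutator_local_le {κ : Type*} [Fintype κ] (V : κ → Finset Λ)
    (q : κ → Matrix (Finset (Orb Λ)) (Finset (Orb Λ)) ℂ)
    (hq : ∀ y, q y ∈ carSubalgebra (orbSet (V y))) {M : ℝ} (hM : ∀ y, ‖q y‖ ≤ M)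
    {A : Finset Λ} {c : Matrix (Finset (Orb Λ)) (Finset (Orb Λ)) ℂ}
    (hc : c ∈ carEvenSubalgebra (orbSet A)) :
    ∑ y, ‖q y * c - c * q y‖ ≤
      (Finset.univ.filter fun y => ¬ Disjoint A (V y)).card * (2 * M * ‖c‖) := by
  have hvanish : ∀ y, Disjoint A (V y) → q y * c - c * q y = 0 := fun y hy =>
    sub_eq_zero.mpr (commute_of_mem_carEvenSubalgebra hc (hq y) (disjoint_orbSet hy)).eq.symm
  rw [← Finset.sum_filter_of_ne (p := fun y => ¬ Disjoint A (V y))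
    (fun y _ hne hdis => hne (by rw [hvanish y hdis, norm_zero]))]
  calc ∑ y ∈ Finset.univ.filter (fun y => ¬ Disjoint A (V y)), ‖q y * c - c * q y‖
      ≤ ∑ _y ∈ Finset.univ.filter (fun y => ¬ Disjoint A (V y)), 2 * M * ‖c‖ :=
        Finset.sum_le_sum fun y _ => by
          calc ‖q y * c - c * q y‖ ≤ ‖q y * c‖ + ‖c * q y‖ := norm_sub_le _ _
            _ ≤ ‖q y‖ * ‖c‖ + ‖c‖ * ‖q y‖ := add_le_add (norm_mul_le _ _) (norm_mul_le _ _)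
            _ = 2 * ‖q y‖ * ‖c‖ := by ring
            _ ≤ 2 * M * ‖c‖ := by gcongr; exact hM y
    _ = (Finset.univ.filter fun y => ¬ Disjoint A (V y)).card * (2 * M * ‖c‖) := by
        rw [Finset.sum_const, nsmul_eq_mul]

omit [Fintype Λ] [DecidableRel G.Adj] in
/-- A local Hubbard term lives on at most two sites. [folklore] -/
theorem dc_card_hubbardTermSupp_le_two (Z : HubbardIdx G) : (hubbardTermSupp G Z).card ≤ 2 := by
  cases Z with
  | inl p => exact Finset.card_insert_le _ _ |>.trans (by simp)
  | inr x => simp [hubbardTermSupp]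

/-- **The double-commutator bound, general form.** On a finite graph of maximal degree `≤ Δ`, let
`q_y` (`y : κ`) be even observables localised on site sets `V y` of size `≤ s`, with `‖q_y‖ ≤ M`,
such that every set `A` of sites meets `V y` for at most `|A| · s` values of `y`. Then for
`O = Σ_y q_y` and `H = H(t,U) - μN`,
`‖[O, [O, H]]‖ ≤ 4 |κ| s²(s+2)(2Δ+1) M² (2|t| + |U| + 2|μ|)`:
`[O,[O,H]] = Σ_x Σ_Z Σ_y [q_y, [q_x, h_Z]]`, the `Z`-sum has `≤ s(2Δ+1)` non-zero terms of norm
`≤ 2M ‖h_Z‖`, and for each of them the `y`-sum has `≤ (s+2)s` non-zero terms (graded locality,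
Bratteli–Robinson II §5.2.2), each of norm `≤ 2M ‖[q_x, h_Z]‖`. Koma–Tasaki 1994, proof of
Theorem 2.2 (there with commuting `o_x`). [cite: KomaTasaki1994, Theorem 2.2] -/
theorem dc_norm_doubleCommutator_le {Δ s : ℕ}
    (hΔ : ∀ x : Λ, (Finset.univ.filter fun y => G.Adj x y).card ≤ Δ) (t U μ : ℝ)
    {κ : Type*} [Fintype κ] (V : κ → Finset Λ) (q : κ → Matrix (Finset (Orb Λ)) (Finset (Orb Λ)) ℂ)
    (hq : ∀ y, q y ∈ carEvenSubalgebra (orbSet (V y))) {M : ℝ} (hM0 : 0 ≤ M) (hM : ∀ y, ‖q y‖ ≤ M)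
    (hV : ∀ y, (V y).card ≤ s)
    (hN : ∀ A : Finset Λ, (Finset.univ.filter fun y => ¬ Disjoint A (V y)).card ≤ A.card * s) :
    ‖(∑ y, q y) * ((∑ y, q y) * hamiltonianWith G t U μ - hamiltonianWith G t U μ * ∑ y, q y) -
        ((∑ y, q y) * hamiltonianWith G t U μ - hamiltonianWith G t U μ * ∑ y, q y) * ∑ y, q y‖ ≤
      4 * Fintype.card κ * (s ^ 2 * (s + 2) * (2 * Δ + 1) : ℕ) * M ^ 2 * (2 * |t| + |U| + 2 * |μ|) := by
  have hq' : ∀ y, q y ∈ carSubalgebra (orbSet (V y)) := fun y =>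
    carEvenSubalgebra_le_carSubalgebra _ (hq y)
  -- Step 1: expand `[O, [O, H]] = Σ_x Σ_Z Σ_y [q_y, [q_x, h_Z]]`
  rw [← sum_hubbardTermOp G t U μ]
  have h1 : (∑ x, q x) * (∑ Z, hubbardTermOp G t U μ Z) - (∑ Z, hubbardTermOp G t U μ Z) * ∑ x, q x =
      ∑ x, ∑ Z, (q x * hubbardTermOp G t U μ Z - hubbardTermOp G t U μ Z * q x) := by
    rw [finset_sum_commutator]
    exact Finset.sum_congr rfl fun x _ => dc_commutator_finset_sum _ _ _
  have hexp : (∑ y, q y) * (∑ x, ∑ Z, (q x * hubbardTermOp G t U μ Z - hubbardTermOp G t U μ Z * q x)) -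
      (∑ x, ∑ Z, (q x * hubbardTermOp G t U μ Z - hubbardTermOp G t U μ Z * q x)) * ∑ y, q y =
      ∑ x, ∑ Z, ∑ y, (q y * (q x * hubbardTermOp G t U μ Z - hubbardTermOp G t U μ Z * q x) -
        (q x * hubbardTermOp G t U μ Z - hubbardTermOp G t U μ Z * q x) * q y) := by
    rw [dc_commutator_finset_sum]
    refine Finset.sum_congr rfl fun x _ => ?_
    rw [dc_commutator_finset_sum]
    refine Finset.sum_congr rfl fun Z _ => ?_
    exact finset_sum_commutator _ _ _
  rw [h1, hexp]
  -- Step 2: the `y`-sum, for fixed `x, Z`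
  have hF : ∀ x Z, ∑ y, ‖q y * (q x * hubbardTermOp G t U μ Z - hubbardTermOp G t U μ Z * q x) -
      (q x * hubbardTermOp G t U μ Z - hubbardTermOp G t U μ Z * q x) * q y‖ ≤
      ((s + 2) * s : ℕ) * (2 * M * ‖q x * hubbardTermOp G t U μ Z - hubbardTermOp G t U μ Z * q x‖) := by
    intro x Z
    have hc := dc_commutator_hubbardTermOp_mem_carEvenSubalgebra G t U μ (hq x) Z
    refine (dc_sum_norm_commutator_local_le V q hq' hM hc).trans ?_
    have hcard : (Finset.univ.filter fun y => ¬ Disjoint (V x ∪ hubbardTermSupp G Z) (V y)).card ≤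
        (s + 2) * s := by
      refine (hN _).trans (Nat.mul_le_mul_right _ ?_)
      exact (Finset.card_union_le _ _).trans (add_le_add (hV x) (dc_card_hubbardTermSupp_le_two G Z))
    have hnn : 0 ≤ 2 * M * ‖q x * hubbardTermOp G t U μ Z - hubbardTermOp G t U μ Z * q x‖ := by
      positivity
    exact mul_le_mul_of_nonneg_right (by exact_mod_cast hcard) hnn
  -- Step 3: the `Z`-sum, for fixed `x`
  have hZsum : ∀ x, ∑ Z, ‖q x * hubbardTermOp G t U μ Z - hubbardTermOp G t U μ Z * q x‖ ≤
      (s * (2 * Δ + 1) : ℕ) * (2 * (2 * |t| + |U| + 2 * |μ|) * M) := by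
    intro x
    refine (dc_sum_norm_commutator_hubbardTermOp_le G hΔ t U μ (hq' x)).trans ?_
    have h1 : (((V x).card * (2 * Δ + 1) : ℕ) : ℝ) ≤ ((s * (2 * Δ + 1) : ℕ) : ℝ) := by
      exact_mod_cast Nat.mul_le_mul_right _ (hV x)
    calc (((V x).card * (2 * Δ + 1) : ℕ) : ℝ) * (2 * (2 * |t| + |U| + 2 * |μ|) * ‖q x‖)
        ≤ ((s * (2 * Δ + 1) : ℕ) : ℝ) * (2 * (2 * |t| + |U| + 2 * |μ|) * ‖q x‖) :=
          mul_le_mul_of_nonneg_right h1 (by positivity)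
      _ ≤ ((s * (2 * Δ + 1) : ℕ) : ℝ) * (2 * (2 * |t| + |U| + 2 * |μ|) * M) := by
          gcongr
          exact hM x
  -- Step 4: assemble
  calc ‖∑ x, ∑ Z, ∑ y, (q y * (q x * hubbardTermOp G t U μ Z - hubbardTermOp G t U μ Z * q x) -
          (q x * hubbardTermOp G t U μ Z - hubbardTermOp G t U μ Z * q x) * q y)‖
      ≤ ∑ x, ‖∑ Z, ∑ y, (q y * (q x * hubbardTermOp G t U μ Z - hubbardTermOp G t U μ Z * q x) -
          (q x * hubbardTermOp G t U μ Z - hubbardTermOp G t U μ Z * q x) * q y)‖ := norm_sum_le _ _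
    _ ≤ ∑ x, ∑ Z, ‖∑ y, (q y * (q x * hubbardTermOp G t U μ Z - hubbardTermOp G t U μ Z * q x) -
          (q x * hubbardTermOp G t U μ Z - hubbardTermOp G t U μ Z * q x) * q y)‖ :=
        Finset.sum_le_sum fun x _ => norm_sum_le _ _
    _ ≤ ∑ x, ∑ Z, ∑ y, ‖q y * (q x * hubbardTermOp G t U μ Z - hubbardTermOp G t U μ Z * q x) -
          (q x * hubbardTermOp G t U μ Z - hubbardTermOp G t U μ Z * q x) * q y‖ :=
        Finset.sum_le_sum fun x _ => Finset.sum_le_sum fun Z _ => norm_sum_le _ _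
    _ ≤ ∑ x, ∑ Z, ((s + 2) * s : ℕ) *
          (2 * M * ‖q x * hubbardTermOp G t U μ Z - hubbardTermOp G t U μ Z * q x‖) :=
        Finset.sum_le_sum fun x _ => Finset.sum_le_sum fun Z _ => hF x Z
    _ = ((s + 2) * s : ℕ) * (2 * M) *
          ∑ x, ∑ Z, ‖q x * hubbardTermOp G t U μ Z - hubbardTermOp G t U μ Z * q x‖ := by
        rw [Finset.mul_sum]
        refine Finset.sum_congr rfl fun x _ => ?_
        rw [Finset.mul_sum]
        refine Finset.sum_congr rfl fun Z _ => ?_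
        ring
    _ ≤ ((s + 2) * s : ℕ) * (2 * M) *
          ∑ _x : κ, ((s * (2 * Δ + 1) : ℕ) : ℝ) * (2 * (2 * |t| + |U| + 2 * |μ|) * M) := by
        gcongr with x _
        exact hZsum x
    _ = 4 * Fintype.card κ * (s ^ 2 * (s + 2) * (2 * Δ + 1) : ℕ) * M ^ 2 * (2 * |t| + |U| + 2 * |μ|) := by
        rw [Finset.sum_const, Finset.card_univ, nsmul_eq_mul]
        push_cast
        ring

end General

/-! ### Specialisation to the pair field on the torus -/

section Torus

variable (g : Site 2 → ℝ) (L : ℕ) [NeZero L]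

/-- `‖P_y + P_y†‖ ≤ 2 · 2 Σ_e |g e/√2|`. [folklore] -/
theorem dc_norm_localPair_add_conjTranspose_le (y : TorusSite 2 L) :
    ‖localPair g L y + (localPair g L y)ᴴ‖ ≤
      2 * (2 * ∑ e ∈ insert (0 : Site 2) unitSteps, |g e / Real.sqrt 2|) := by
  have h := norm_localPair_le g L y
  calc ‖localPair g L y + (localPair g L y)ᴴ‖ ≤ ‖localPair g L y‖ + ‖(localPair g L y)ᴴ‖ :=
        norm_add_le _ _
    _ = 2 * ‖localPair g L y‖ := by rw [l2_opNorm_conjTranspose]; ring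
    _ ≤ 2 * (2 * ∑ e ∈ insert (0 : Site 2) unitSteps, |g e / Real.sqrt 2|) := by gcongr

/-- **The double-commutator bound for the pair field on the torus**, for every form factor `g`,
hopping `t`, coupling `U` and chemical potential `μ`: with `O = Δ_g + Δ_g†`,
`H = H(t,U) - μN` on `(ℤ/Lℤ)²`, `s = #{0, ±e₁, ±e₂}` and `K = 2 Σ_e |g e/√2|`,
`‖[O, [O, H]]‖ ≤ 144 s²(s+2) K² (2|t| + |U| + 2|μ|) L²`. The statement is made for an ARBITRARY
`DecidableEq (FermionTorus 2 L)` instance (on which the `L²`-operator norm depends syntactically):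
instance resolution on the concrete torus finds the computable `instDecidableEqLex`, the generic
lemmas carry `LinearOrder.toDecidableEq`; the proof substitutes the latter. [cite: KomaTasaki1994, Theorem 2.2] -/
theorem dc_norm_doubleCommutator_pairField_le (t U μ : ℝ) [inst : DecidableEq (FermionTorus 2 L)] :
    ‖(pairField g L + (pairField g L)ᴴ) *
          ((pairField g L + (pairField g L)ᴴ) * hubbardTorusWith 2 L t U μ -
            hubbardTorusWith 2 L t U μ * (pairField g L + (pairField g L)ᴴ)) -
        ((pairField g L + (pairField g L)ᴴ) * hubbardTorusWith 2 L t U μ -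
            hubbardTorusWith 2 L t U μ * (pairField g L + (pairField g L)ᴴ)) *
          (pairField g L + (pairField g L)ᴴ)‖ ≤
      144 * ((insert (0 : Site 2) unitSteps).card : ℝ) ^ 2 * ((insert (0 : Site 2) unitSteps).card + 2) *
        (2 * ∑ e ∈ insert (0 : Site 2) unitSteps, |g e / Real.sqrt 2|) ^ 2 *
        (2 * |t| + |U| + 2 * |μ|) * (L : ℝ) ^ 2 := by
  have hinst : inst = LinearOrder.toDecidableEq := Subsingleton.elim _ _
  subst hinst
  letI hdec : DecidableEq (FermionTorus 2 L) := LinearOrder.toDecidableEq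
  set S : Finset (Site 2) := insert 0 unitSteps with hS_def
  set K : ℝ := 2 * ∑ e ∈ S, |g e / Real.sqrt 2| with hK_def
  -- the local observables `q_y = P_y + P_y†` and their supports
  set q : TorusSite 2 L → Matrix (Finset (Orb (FermionTorus 2 L))) (Finset (Orb (FermionTorus 2 L))) ℂ :=
    fun y => localPair g L y + (localPair g L y)ᴴ with hq_def
  set V : TorusSite 2 L → Finset (FermionTorus 2 L) :=
    fun y => S.image fun e => FermionTorus.ofTorusSite (y + Torus.proj L e) with hV_def
  have hq : ∀ y, q y ∈ carEvenSubalgebra (orbSet (V y)) := by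
    intro y
    have h0 : Torus.proj L (0 : Site 2) = 0 := funext fun i => by simp
    have hy : FermionTorus.ofTorusSite y ∈ V y :=
      Finset.mem_image.2 ⟨0, Finset.mem_insert_self _ _, by rw [h0, add_zero]⟩
    have he : ∀ e ∈ S, FermionTorus.ofTorusSite (y + Torus.proj L e) ∈ V y := fun e he =>
      Finset.mem_image_of_mem _ he
    simp only [hq_def]
    rw [Literature.Barriers.HubbardSuperconductivity.localPair_eq_sum_bondPair]
    exact dc_sum_smul_bondPair_add_conjTranspose_mem S _ _ hy he
  have hM : ∀ y, ‖q y‖ ≤ 2 * K := fun y => dc_norm_localPair_add_conjTranspose_le g L y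
  have hV : ∀ y, (V y).card ≤ S.card := fun y => Finset.card_image_le
  have hO : pairField g L + (pairField g L)ᴴ = ∑ y, q y := by
    rw [pairField, conjTranspose_sum, ← Finset.sum_add_distrib]
  have key := dc_norm_doubleCommutator_le (fermionTorusGraph 2 L) (Δ := 4) (s := S.card)
    (fun x => SourceGas.card_filter_fermionTorusGraph_adj_le x) t U μ V q hq (M := 2 * K)
    (by positivity) hM hV ?_
  · rw [hO, hubbardTorusWith]
    refine key.trans (le_of_eq ?_)
    rw [card_torusSite_two]
    push_cast
    ring
  · -- counting: `A` meets `V y` only for `y = w - e`, `w ∈ A`, `e ∈ S`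
    -- (the subset is taken from the goal, whose decidability instances are the generic ones)
    intro A
    refine (Finset.card_le_card (t := A.biUnion fun w => S.image fun e =>
      FermionTorus.toTorusSite w - Torus.proj L e) fun y hy => ?_).trans ?_
    · rw [Finset.mem_filter] at hy
      obtain ⟨w, hwA, hwV⟩ := Finset.not_disjoint_iff.1 hy.2
      obtain ⟨e, he, hwe⟩ := Finset.mem_image.1 hwV
      refine Finset.mem_biUnion.2 ⟨w, hwA, Finset.mem_image.2 ⟨e, he, ?_⟩⟩
      rw [← hwe, FermionTorus.toTorusSite_ofTorusSite, add_sub_cancel_right]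
    · calc (A.biUnion fun w => S.image fun e => FermionTorus.toTorusSite w - Torus.proj L e).card
          ≤ ∑ w ∈ A, (S.image fun e => FermionTorus.toTorusSite w - Torus.proj L e).card :=
            Finset.card_biUnion_le
        _ ≤ ∑ _w ∈ A, S.card := Finset.sum_le_sum fun w _ => Finset.card_image_le
        _ = A.card * S.card := by rw [Finset.sum_const, smul_eq_mul]

end Torus

/-! ### The stub -/

/-- **Stub S1b** of the line `lro-seed-kink-bridge` (crux `WcbcsBcsConstruction`): locality bound on
the double commutator of the `d`-wave order operator `O = Δ_d + Δ_d†` with the grand-canonical torus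
Hubbard Hamiltonian `H = H(1,U) - μN`: `‖[O, [O, H]]‖ ≤ B₂ (1 + U + |μ|) L²` for `U ≥ 0`, with
`B₂ = 288 s²(s+2) K² + 1`, `s = #{0, ±e₁, ±e₂}`, `K = 2 Σ_e |d(e)/√2|` — `O = Σ_x q_x` with `q_x`
even and supported on `x` and its four neighbours, `[q_x, H]` even and supported within graph
distance one of that set, and `[q_y, [q_x, H]] = 0` unless the supports meet (graded locality), so
only `O(1)` values of `y` per `x` survive. Koma–Tasaki 1994, proof of Thm 2.2, with the norm count
replacing `[o_x, o_y] = 0` (which fails for overlapping bond pairs). [cite: KomaTasaki1994, Theorem 2.2] -/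
theorem stub_doubleCommutatorBound :
    ∃ B₂ : ℝ, 0 < B₂ ∧ ∀ (L : ℕ) [NeZero L] (U μ : ℝ), 0 ≤ U →
      ‖(pairField dWaveFormFactor L + (pairField dWaveFormFactor L)ᴴ) *
            ((pairField dWaveFormFactor L + (pairField dWaveFormFactor L)ᴴ) * hubbardTorusWith 2 L 1 U μ -
              hubbardTorusWith 2 L 1 U μ * (pairField dWaveFormFactor L + (pairField dWaveFormFactor L)ᴴ)) -
          ((pairField dWaveFormFactor L + (pairField dWaveFormFactor L)ᴴ) * hubbardTorusWith 2 L 1 U μ -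
              hubbardTorusWith 2 L 1 U μ * (pairField dWaveFormFactor L + (pairField dWaveFormFactor L)ᴴ)) *
            (pairField dWaveFormFactor L + (pairField dWaveFormFactor L)ᴴ)‖ ≤
        B₂ * (1 + U + |μ|) * (L : ℝ) ^ 2 := by
  set s : ℕ := (insert (0 : Site 2) unitSteps).card with hs_def
  set K : ℝ := 2 * ∑ e ∈ insert (0 : Site 2) unitSteps, |dWaveFormFactor e / Real.sqrt 2| with hK_def
  refine ⟨288 * (s : ℝ) ^ 2 * (s + 2) * K ^ 2 + 1, by positivity, fun L _ U μ hU => ?_⟩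
  have key := dc_norm_doubleCommutator_pairField_le dWaveFormFactor L 1 U μ
  refine key.trans ?_
  have hJ : 2 * |(1 : ℝ)| + |U| + 2 * |μ| ≤ 2 * (1 + U + |μ|) := by
    rw [abs_one, abs_of_nonneg hU]
    linarith [abs_nonneg μ]
  have hL : (0 : ℝ) ≤ (L : ℝ) ^ 2 := by positivity
  have hC : (0 : ℝ) ≤ 144 * (s : ℝ) ^ 2 * (s + 2) * K ^ 2 := by positivity
  have h1 : (0 : ℝ) ≤ 1 + U + |μ| := by positivity
  calc 144 * (s : ℝ) ^ 2 * (s + 2) * K ^ 2 * (2 * |(1 : ℝ)| + |U| + 2 * |μ|) * (L : ℝ) ^ 2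
      ≤ 144 * (s : ℝ) ^ 2 * (s + 2) * K ^ 2 * (2 * (1 + U + |μ|)) * (L : ℝ) ^ 2 := by gcongr
    _ = (288 * (s : ℝ) ^ 2 * (s + 2) * K ^ 2) * (1 + U + |μ|) * (L : ℝ) ^ 2 := by ring
    _ ≤ (288 * (s : ℝ) ^ 2 * (s + 2) * K ^ 2 + 1) * (1 + U + |μ|) * (L : ℝ) ^ 2 := by
        gcongr
        linarith

end Summit.HubbardSuperconductivity.HubbardSuperconductivity.Theorems
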